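import Mathlib.Topology.UniformSpace.LocallyUniformConvergence
import Literature.Analysis.FluidPDE.KNSSTypeIRate
import Literature.Analysis.FluidPDE.NSBoundedMildOseen
import HarnessLib

/-!
# KNSS 2009, proof of Theorem 6.2, Steps 5–6 cut into their three printed ingredients:
# compactness (Lemma 6.1), the Liouville step (Theorem 5.1 with Remark 6.1), the vertex estimate

Analysis/FluidPDE facts file, second layer of the decomposition of
`Literature.Analysis.FluidPDE.KNSS2009_regularity_typeI_rate` (`KNSSTypeII`; Koch–Nadirashvili–
Seregin–Šverák, Acta Math. 203 (2009) = arXiv:0709.3599, Theorem 6.2). The first layer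
(`KNSSTypeIRate`) reduced Theorem 6.2 to Theorem 6.1 and to the single named fact
`KNSS2009_typeI_rate_blowupSequence` = Steps 5–6 of the printed proof (arXiv p. 13) in the form
used: a doubly rescaled blow-up sequence `w⁽ᵏ⁾` with the printed symmetry and bounds has
`w⁽ᵏ⁾(0, 0) → 0`. The printed argument for this consists of three analytic ingredients and
elementary glue:

1. **Compactness** (`KNSS2009_typeI_rate_compactness`): "Since the functions `w⁽ᵏ⁾` are mild
   solutions of the Navier–Stokes equations in `(A_k, 0)` …, in view of bound (wkbound3) we can
   choose a subsequence of the sequence `w⁽ᵏ⁾` … such that the `w⁽ᵏ⁾` converge uniformly on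
   compact subsets of `ℝ³ × (−∞, 0)` to an ancient mild solution `w`" — KNSS Lemma 6.1
   (p. 11, "an easy consequence of the results in Section 4"), applied on the windows
   `(−∞, −δ)` where (wkbound3) is a uniform bound, together with the mildness of the `w⁽ᵏ⁾`
   (first paragraph of the proof of Theorem 6.2, from the proof of Theorem 6.1, p. 12: a bounded
   solution whose slices decay at horizontal infinity has no parasitic part `b(t)` in the
   decomposition of Lemma 3.1) and a diagonal argument;
2. **Liouville** (`KNSS2009_typeI_rate_liouville`): "In view of (wkbound) we have `|w| ≤ 2` …
   `w` is independent of the `x₂`-variable. Applying Theorem 5.1 and Remark 6.1 to the field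
   `(w₁, w₃)`, we conclude that `(w₁, w₃)` must vanish identically, and this easily implies that
   `w = 0` in `ℝ³ × (−∞, 0)`" — Theorem 5.1 (the planar Liouville theorem, p. 9; named fact
   `KNSS2009_liouville_planar` for bounded weak solutions in `ℝ²`), Remark 6.1 (proved in the
   tree for the Oseen rendering: `KNSS2009_remark61`, file `KNSSRemark61`), the bound
   `|w| ≤ C/√(−τ)` to kill the constant, and for `w₂` the Liouville theorem for bounded ancient
   caloric functions (proved: `Literature.Analysis.UnboundedOperators.heat_liouville_ancient`,
   file `HeatLiouville`);
3. **The vertex** (`KNSS2009_typeI_rate_vertex`): the representation formula (3.3) on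
   `ℝ³ × (−1, 0)` with datum `w⁽ᵏ⁾(·, −1)`, the kernel decay (3.8), (wkbound), (wkbound2) and
   `I(M) → 0` show that "the sequence `w⁽ᵏ⁾` converges to `w` uniformly in `B̄(0, 1) × [−1, 0]`"
   — equivalently, given the locally uniform convergence for `τ < 0`, the `w⁽ᵏ⁾` are
   *asymptotically equicontinuous at the vertex*, which is the form recorded here;

while the glue — the independence of `x₂` of the limit ("since the solutions `v⁽ᵏ⁾` are
axi-symmetric and `M_k ↗ ∞`", proved: `eq_of_tendstoLocallyUniformly_of_rot_about`, file
`KNSSTypeIRateLimit`), the bound `|w| ≤ K` of the limit (the cylinders `𝒞_k` recede), the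
passage of (wkbound3) to the limit, and the final `ε/2`-argument at the vertex along
subsequences — is **proved** in the companion file `KNSSTypeIRateCoreProofs`
(`KNSS2009_typeI_rate_blowupSequence_of_core : compactness → liouville → vertex →
KNSS2009_typeI_rate_blowupSequence`). The three facts are stated over the data of
`KNSS2009_typeI_rate_blowupSequence` (a sequence of classical solutions `(w⁽ᵏ⁾, q⁽ᵏ⁾)` on
`ℝ³ × (A_k, B_k)` with `M_k → ∞`, `A_k → −∞`, `B_k > 0` and the bounds (wkbound)–(wkbound3)) and
over the **Oseen integral equation** `W(t) = e^{(t−s)Δ} W(s) − B¹_s(W, W)(t)` of the tree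
(`UnboundedOperators.heatExtension`, `oseenDuhamel` of `NSBoundedMildOseen`, kernel `oseenKernel`
of `KochTataru`), which is KNSS's notion of mild solution (§3, p. 6, the representation formula
with `f_{jk} = −u_k u_j`; §4 (i), p. 8) — the notion in which Remark 6.1 holds.

## Rendering choices

* **The limit** `W : ℝ → ℝ³ → ℝ³` is recorded with what Steps 5–6 use: joint continuity on
  `(−∞, 0) × ℝ³` (KNSS: the limit is smooth, §4), the Oseen integral equation between *all*
  pairs of times `s < t < 0` and at every point (KNSS's ancient mild solutions are mild from a
  sequence of times `T_l → −∞`, p. 11; for bounded smooth solutions the equation restarts at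
  every intermediate time, cf. the named fact `oseenMild_restart` of `NSBoundedMildOseen`),
  weakly divergence-free slices (part of being a Navier–Stokes solution), the bound
  `√(−t)‖W(t, x)‖ ≤ C` inherited from (wkbound3), and **slice-wise** locally uniform convergence
  `w⁽ᵠ⁽ᵏ⁾⁾(·, t) → W(·, t)` for every `t < 0` (weaker than the printed joint locally uniform
  convergence, and all the glue needs).
* **The vertex fact** records asymptotic equicontinuity in time at `x = 0`:
  `∀ ε > 0 ∃ δ > 0`, for all large `k` and `τ ∈ [−δ, 0]`, `‖w⁽ᵏ⁾(0, 0) − w⁽ᵏ⁾(0, τ)‖ ≤ ε`. This is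
  what the printed uniform convergence on `B̄(0, 1) × [−1, 0]` amounts to for the sequence
  itself (its proof splits `w⁽ᵏ⁾` on `(−1, 0]` by (3.3) into the caloric part with datum
  bounded by `C`, the Duhamel part fed by `|w⁽ᵏ⁾| ≤ K` off `𝒞_k` — both equicontinuous near the
  vertex uniformly in `k` by the estimates of §3 — and the Duhamel part fed by `𝒞_k`, which is
  `O(I(M_k)) → 0`).
* Hypotheses not used by an ingredient are not repeated in it (the symmetry enters only the
  glue; the off-cylinder bound (wkbound) enters the Liouville step through the glue and the
  vertex step).
* **Status of the three facts.** Only the vertex estimate is irreducibly new content. The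
  compactness fact and the Liouville fact are COARSE: they re-compress accepted facts of the
  tree (`KNSS2009_weak_driftMild`, `KNSS2009_regularity_boundedWeak_window`,
  `knss2009_smoothing`; `KNSS2009_liouville_planar`) together with pieces the tree does not yet
  have (listed in their docstrings), and are retained provisionally as the precise targets
  against which the next layer of this unit discharges them — the glue in
  `KNSSTypeIRateCoreProofs` is already proved against these statements. See the docstrings for
  the derivation route along the proved sibling chain of Theorem 6.1 (`KNSSWindowLipschitz`,
  `KNSSTypeIIZoomIn`, `KNSSBlowupLimit`).

## References

* G. Koch, N. Nadirashvili, G. Seregin, V. Šverák, *Liouville theorems for the Navier–Stokes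
  equations and applications*, Acta Math. 203 (2009) 83–105 = arXiv:0709.3599 (arXiv pages):
  proof of Theorem 6.2, p. 13; Lemma 6.1 and Remark 6.1, p. 11; Theorem 6.1, proof, p. 12;
  Theorem 5.1, p. 9; §3 (3.3), (3.8), Lemma 3.1, pp. 6–7; §4, p. 8.
  [KochNadirashviliSereginSverak2009]
-/

noncomputable section

open MeasureTheory Set Function Filter Topology TopologicalSpace
open scoped NNReal ENNReal

namespace Literature.Analysis.FluidPDE

/-- Local notation for physical space `ℝ³ = EuclideanSpace ℝ (Fin 3)`. -/
local notation "ℝ³" => EuclideanSpace ℝ (Fin 3)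

/-! ### Ingredient 1: compactness of the doubly rescaled sequence (KNSS Lemma 6.1) -/

/-- **KNSS 2009, Lemma 6.1 in the form used in the proof of Theorem 6.2** (Acta Math. 203
(2009) = arXiv:0709.3599. Lemma 6.1, p. 11: "Assume that `u_l` is a sequence of bounded mild
solutions of Navier–Stokes defined in `ℝⁿ × (T_l, 0)` (for some initial data) with a uniform
bound `|u_l| ≤ C`, and `T_l ↘ −∞`. Then we can choose a subsequence such that along the
subsequence the `u_l` converge locally uniformly in `ℝⁿ × (−∞, 0)` to an ancient mild solution
`u` satisfying `|u| ≤ C`." Its use, p. 13: "Since the functions `w⁽ᵏ⁾` are mild solutions … in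
view of bound (wkbound3) we can choose a subsequence … such that the `w⁽ᵏ⁾` converge uniformly
on compact subsets of `ℝ³ × (−∞, 0)` to an ancient mild solution `w`.") **Statement.** Let
`C, K > 0`, `M_k > 0` with `M_k → ∞`, `A_k → −∞`, `B_k > 0`, and let `(w⁽ᵏ⁾, q⁽ᵏ⁾)` be classical
solutions of the unforced Navier–Stokes system (`ν = 1`) on `ℝ³ × (A_k, B_k)`, each bounded on
`ℝ³ × (A_k, 0]`, with (wkbound3) `√(−τ)‖w⁽ᵏ⁾(x, τ)‖ ≤ C` for `A_k < τ < 0` and (wkbound2)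
`‖w⁽ᵏ⁾(x, τ)‖(M_k√(−τ) + ρ_k(x)) ≤ K M_k` for `A_k < τ ≤ 0`, `ρ_k(x) = cylRadius (x − c_k)`,
`c_k = −M_k e₁` (so every slice decays at horizontal infinity, which with boundedness makes
`w⁽ᵏ⁾` a mild solution on `[a, 0]`, `a > A_k`, by Lemma 3.1 as in the proof of Theorem 6.1,
p. 12). Then there are a subsequence `φ` and a field `W : ℝ → ℝ³ → ℝ³`, jointly continuous on
`(−∞, 0) × ℝ³`, with weakly divergence-free slices, satisfying `√(−t)‖W(t, x)‖ ≤ C` and the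
Oseen integral equation `W(t) = e^{(t−s)Δ} W(s) − B¹_s(W, W)(t)` pointwise for all `s < t < 0`
(`UnboundedOperators.heatExtension`, `oseenDuhamel`: an ancient mild solution in KNSS's sense,
module docstring), such that for every `t < 0` the slices `w⁽ᵠ⁽ᵏ⁾⁾(·, t)` converge to `W(·, t)`
locally uniformly on `ℝ³` (Lemma 6.1 on the windows `(−∞, −δ)`, where (wkbound3) is a uniform
bound, and a diagonal argument; slice-wise convergence is the part of the printed conclusion
that is used). **Status: a COARSE fact, retained provisionally as the target of the next layer
of this unit; it re-compresses finer material the tree already has.** Namely: Lemma 3.1 is the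
accepted fact `KNSS2009_weak_driftMild` (`KNSSRegularityDecomposition`: the drift-mild identity
`U(t) = e^{(t−s)Δ}U(s) − driftDuhamel U b s t` between all window times, `u = U + b(t)`), §4 is
`KNSS2009_regularity_boundedWeak_window` / `KNSS2009_driftMild_regularity`, Prop. 4.1 is
`knss2009_smoothing` (`NSBoundedMildOseen`), and the sibling step of the proof of Theorem 6.1
("by Lemma 6.1", p. 12) is PROVED in the tree from those facts along the chain
`KNSS2009_regularity_boundedWeak_window.lipschitz_of_cylRadius_bound` (`KNSSWindowLipschitz`) →
`lipschitz_up_to_final_time` (`KNSSTypeIIZoomIn`) → `exists_strictMono_tendsto_of_lipschitzWith`,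
`isBoundedWeakNSSolutionOn_of_tendsto` (`KNSSBlowupLimit`), with
`IsClassicalNSSolutionOn.isBoundedWeakNSSolutionOn` (`ClassicalBoundedWeak`). Along that chain
the present statement should be DERIVED rather than assumed: on the unit windows inside
`(−∞, −δ]` (wkbound3) is the uniform bound `C/√δ` and (wkbound2) is the per-`k` decay
`ρ_k‖w⁽ᵏ⁾‖ ≤ K M_k` the Lipschitz bound needs (any constant is allowed there; the axis is
translated), a diagonal over `δ = 1/m` gives the slice-wise convergence, and continuity, the
`√(−t)` bound and divergence-freeness pass to the limit. What the tree does NOT yet have, and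
why the fact is not derived here: (i) the Oseen clause of the limit — it requires the drift of
the `w⁽ᵏ⁾` in `KNSS2009_weak_driftMild` to be constant (the Lemma 3.1 corollary under horizontal
decay, last paragraph of the proof of Thm. 6.1, p. 12, not vendored) and the passage of the
drift-mild identity to pointwise bounded limits (dominated convergence for `driftDuhamel`);
(ii) the identification of the two Oseen renderings of the tree, `driftDuhamel`/`oseenHeat`
(`OseenHeat`, used by the §4 facts) and `oseenDuhamel`/`oseenKernel` (`NSBoundedMildOseen`,
`KochTataru`, used here and by `KNSS2009_remark61`), which are the same operator
`∫ₛᵗ e^{(t−σ)Δ}P∇·(u ⊗ u) dσ` written through heat derivatives resp. the closed Gaussian kernel;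
(iii) the space-translation covariance of `IsBoundedWeakNSSolutionOn` and the extraction under
the non-uniform bound `C/√(−τ)`. A discharge of this fact against (i)–(iii) and the accepted
facts above is the next work item of the unit; until then its trust content beyond the accepted
§4 facts is exactly (i). [cite: KochNadirashviliSereginSverak2009, Lemma 6.1 (arXiv p. 11) and proof of Thm 6.2 (p. 13)] -/
def KNSS2009_typeI_rate_compactness : Prop :=
  ∀ ⦃C K : ℝ⦄ ⦃M A B : ℕ → ℝ⦄ ⦃w : ℕ → ℝ → ℝ³ → ℝ³⦄ ⦃q : ℕ → ℝ → ℝ³ → ℝ⦄,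
    0 < C → 0 < K → (∀ k, 0 < M k) → Tendsto M atTop atTop → Tendsto A atTop atBot →
    (∀ k, 0 < B k) →
    (∀ k, IsClassicalNSSolutionOn (Ioo (A k) (B k)) 1 0 (w k) (q k)) →
    (∀ k, ∃ L : ℝ, ∀ τ ∈ Ioc (A k) 0, ∀ x, ‖w k τ x‖ ≤ L) →
    (∀ k, ∀ τ ∈ Ioo (A k) 0, ∀ x, Real.sqrt (-τ) * ‖w k τ x‖ ≤ C) →
    (∀ k, ∀ τ ∈ Ioc (A k) 0, ∀ x,
      ‖w k τ x‖ * (M k * Real.sqrt (-τ) + cylRadius (x - EuclideanSpace.single 0 (-M k))) ≤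
        K * M k) →
    ∃ (φ : ℕ → ℕ) (W : ℝ → ℝ³ → ℝ³), StrictMono φ ∧
      ContinuousOn (uncurry W) (Iio 0 ×ˢ univ) ∧
      (∀ t < 0, IsWeaklyDivFree (W t)) ∧
      (∀ t < 0, ∀ x, Real.sqrt (-t) * ‖W t x‖ ≤ C) ∧
      (∀ s t : ℝ, s < t → t < 0 → ∀ x,
        W t x = UnboundedOperators.heatExtension (W s) (t - s) x - oseenDuhamel 1 s W W t x) ∧
      (∀ t < 0, TendstoLocallyUniformly (fun k => w (φ k) t) (W t) atTop)

/-! ### Ingredient 2: the Liouville step (KNSS Theorem 5.1 with Remark 6.1) -/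

/-- **KNSS 2009, the Liouville step of the proof of Theorem 6.2** (Acta Math. 203 (2009) =
arXiv:0709.3599, p. 13: "In view of (wkbound) we have `|w| ≤ 2` in `ℝ³ × (−∞, 0)`. Moreover …
`w` is independent of the `x₂`-variable. Applying Theorem 5.1 and Remark 6.1 to the field
`(w₁, w₃)`, we conclude that `(w₁, w₃)` must vanish identically, and this easily implies that
`w = 0` in `ℝ³ × (−∞, 0)`"; Theorem 5.1, p. 9: a bounded weak solution in `ℝ² × (−∞, 0)` is of
the form `b(t)` — named fact `KNSS2009_liouville_planar`; Remark 6.1, p. 11 — proved,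
`KNSS2009_remark61`). **Statement.** Let `W : ℝ → ℝ³ → ℝ³` be jointly continuous on
`(−∞, 0) × ℝ³`, bounded there, with weakly divergence-free slices, satisfying the Oseen
integral equation `W(t) = e^{(t−s)Δ} W(s) − B¹_s(W, W)(t)` pointwise for all `s < t < 0` (a
bounded ancient mild solution, `ν = 1`), independent of `x₂`
(`W(t, x + δ e₂) = W(t, x)`), and with `√(−t)‖W(t, x)‖ ≤ C`. Then `W = 0` on `(−∞, 0) × ℝ³`. (In
print: `(w₁, w₃)(·, x₂ = const)` is a bounded ancient mild, hence weak, solution in `ℝ²`, so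
`(w₁, w₃) = b(t)` by Theorem 5.1, `b` is constant by Remark 6.1, and `0` by the decay as
`t → −∞`; then `w₂` solves the heat equation — the Duhamel term of `(0, w₂(x₁, x₃), 0)` vanishes
— and is a bounded ancient caloric function, constant by the parabolic Liouville theorem
(`heat_liouville_ancient`) and again `0` by the decay.) **Status: a COARSE fact, retained
provisionally.** Theorem 5.1 is already the accepted fact `KNSS2009_liouville_planar`
(`KNSSLiouville`, for `IsBoundedWeakNSSolutionOn (Iio 0) isOpen_Iio 1` on `ℝ²`; further reduced
in `KNSSLiouvillePlanar`), Remark 6.1 is proved (`KNSS2009_remark61`) and so is the caloric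
Liouville theorem (`Literature.Analysis.UnboundedOperators.heat_liouville_ancient`); the new
analytic content of this fact is only the BRIDGE "an `x₂`-independent bounded ancient field on
`ℝ³` satisfying the Oseen equation has a `(1, 3)`-part which, as a field on `ℝ × ℝ²`, is a
bounded weak solution on each `ℝ² × (−∞, −δ)` and satisfies the planar Oseen equation, and the
`(1, 3)`-part of the Duhamel term of `W₂² e₂ ⊗ e₂` vanishes" (immediate for the heat-derivative
rendering `oseenHeat`, a Gaussian-moment identity `∫(A − r²B) dr = 0` for the closed kernel
`oseenKernel`). The next layer of the unit should state that bridge as the fact and glue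
`KNSS2009_liouville_planar`, `KNSS2009_remark61` and `heat_liouville_ancient` to it, so that
Theorem 5.1 is assumed once in the tree; users take `(h : KNSS2009_typeI_rate_liouville)`. [cite: KochNadirashviliSereginSverak2009, proof of Thm 6.2 (arXiv p. 13) with Thm 5.1 (p. 9) and Remark 6.1 (p. 11)] -/
def KNSS2009_typeI_rate_liouville : Prop :=
  ∀ ⦃C : ℝ⦄ ⦃W : ℝ → ℝ³ → ℝ³⦄,
    ContinuousOn (uncurry W) (Iio 0 ×ˢ univ) →
    (∃ K : ℝ, ∀ t < 0, ∀ x, ‖W t x‖ ≤ K) →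
    (∀ t < 0, IsWeaklyDivFree (W t)) →
    (∀ s t : ℝ, s < t → t < 0 → ∀ x,
      W t x = UnboundedOperators.heatExtension (W s) (t - s) x - oseenDuhamel 1 s W W t x) →
    (∀ t < 0, ∀ (x : ℝ³) (δ : ℝ), W t (x + EuclideanSpace.single 1 δ) = W t x) →
    (∀ t < 0, ∀ x, Real.sqrt (-t) * ‖W t x‖ ≤ C) →
    ∀ t < 0, ∀ x, W t x = 0

/-! ### Ingredient 3: the vertex estimate -/

/-- **KNSS 2009, the vertex estimate of the proof of Theorem 6.2, as asymptotic
equicontinuity** (Acta Math. 203 (2009) = arXiv:0709.3599, p. 13, last paragraph: "This would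
give a contradiction with `|w⁽ᵏ⁾(0, 0)| = 1` if we could prove that `w⁽ᵏ⁾(0, 0) → w(0, 0)`, which
is not immediately obvious since our bound of `sup_x |w⁽ᵏ⁾(x, τ)|` may not be uniform as
`τ → 0`. However, by (wkbound) the only possible problem may occur due to the contribution from
the cylinder `𝒞_k`. … Applying the representation formula (3.3) in `ℝ³ × (−1, 0)` with
`w⁽ᵏ⁾(x, −1)` as initial datum and `f_{jl} = −w⁽ᵏ⁾_l w⁽ᵏ⁾_j` and using the bound (wkbound2)
together with the decay of the kernel (3.8), one sees that it is enough to estimate the integral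
`I(M) = ∫_{−1}^0 ∫ ∫_{|x'| ≤ M/2} (√(−τ) + |x'|/M)^{−2} (M²/4 + x₃²)^{−2} dx' dx₃ dτ` … `I(M) → 0`
as `M → ∞` … and therefore (by (estimates1)) the sequence `w⁽ᵏ⁾` converges to `w` uniformly in
`B̄(0, 1) × [−1, 0]`.") **Statement.** For the data of `KNSS2009_typeI_rate_blowupSequence`
without the symmetry — classical solutions `(w⁽ᵏ⁾, q⁽ᵏ⁾)` (`ν = 1`) on `ℝ³ × (A_k, B_k)`,
`M_k → ∞`, `A_k → −∞`, `B_k > 0`, each bounded on `ℝ³ × (A_k, 0]`, with (wkbound3), (wkbound)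
(`‖w⁽ᵏ⁾‖ ≤ K` off `𝒞_k = {ρ_k ≤ M_k/2}` for `A_k < τ ≤ 0`) and (wkbound2) — the `w⁽ᵏ⁾` are
asymptotically equicontinuous in time at the vertex: for every `ε > 0` there is `δ > 0` such
that for all large `k` and all `τ ∈ [−δ, 0]`, `‖w⁽ᵏ⁾(0, 0) − w⁽ᵏ⁾(0, τ)‖ ≤ ε`. (This is the content
of the printed uniform convergence near the vertex for the sequence itself: by (3.3) on
`(−1, 0]`, `w⁽ᵏ⁾` is the caloric extension of `w⁽ᵏ⁾(−1)` (bounded by `C`) plus the Duhamel term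
fed by `|w⁽ᵏ⁾| ≤ K` off `𝒞_k`, both equicontinuous near the vertex uniformly in `k` by the linear
estimates of §3, plus the Duhamel term fed by `𝒞_k`, which is `O(I(M_k)) → 0`.) Compresses
(3.3), (3.8), the estimates (3.10)–(3.14) and the computation `I(M) → 0`; users take
`(h : KNSS2009_typeI_rate_vertex)`. [cite: KochNadirashviliSereginSverak2009, proof of Thm 6.2, last paragraph (arXiv p. 13)] -/
def KNSS2009_typeI_rate_vertex : Prop :=
  ∀ ⦃C K : ℝ⦄ ⦃M A B : ℕ → ℝ⦄ ⦃w : ℕ → ℝ → ℝ³ → ℝ³⦄ ⦃q : ℕ → ℝ → ℝ³ → ℝ⦄,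
    0 < C → 0 < K → (∀ k, 0 < M k) → Tendsto M atTop atTop → Tendsto A atTop atBot →
    (∀ k, 0 < B k) →
    (∀ k, IsClassicalNSSolutionOn (Ioo (A k) (B k)) 1 0 (w k) (q k)) →
    (∀ k, ∃ L : ℝ, ∀ τ ∈ Ioc (A k) 0, ∀ x, ‖w k τ x‖ ≤ L) →
    (∀ k, ∀ τ ∈ Ioo (A k) 0, ∀ x, Real.sqrt (-τ) * ‖w k τ x‖ ≤ C) →
    (∀ k, ∀ τ ∈ Ioc (A k) 0, ∀ x,
      M k / 2 < cylRadius (x - EuclideanSpace.single 0 (-M k)) → ‖w k τ x‖ ≤ K) →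
    (∀ k, ∀ τ ∈ Ioc (A k) 0, ∀ x,
      ‖w k τ x‖ * (M k * Real.sqrt (-τ) + cylRadius (x - EuclideanSpace.single 0 (-M k))) ≤
        K * M k) →
    ∀ ε > 0, ∃ δ > 0, ∀ᶠ k in atTop, ∀ τ ∈ Icc (-δ) 0, ‖w k 0 0 - w k τ 0‖ ≤ ε

end Literature.Analysis.FluidPDE

end
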